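import Summits.BirchSwinnertonDyer.BirchSwinnertonDyer.Theorems.KimAtThreeD7uTamagawaSharpTower
import Summits.BirchSwinnertonDyer.BirchSwinnertonDyer.Theorems.KimAtThreeD7uTamagawaDefectExponentLe
import HarnessLib

/-!
# The TAMAGAWA-DIVISIBLE bad places, XXI-le: THE WHOLE TOWER with the level families BOUNDED BY THE TOP DEPTH
# — the CONSUMER forms of part XXI (and, at `j = 0`, of parts XVIII §3 / XIX)
# (cell `bsd-addord`, seat w2-tamdiv gen 7; route W2 `KimAtThreeKolyvagin`, items 19562 / 19679 / 19599 / 19560, «TamDiv∞»)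

HONEST FRAMING: TOOL theorems (no definition, no named fact, no `sorry`); closes nothing by itself; nothing is
booked; BSD is not proved by any of this.  Part XXI (`…SharpTower`, p540733) — like parts XIII/XV/XVII–XX — asks
`hD : ∀ i, (D i).HasCanonicalComparison (3^{i+1}) η`, `hadm : ∀ i, (D i).IsAdmissible` for EVERY `i` on ONE prime
set, a family no curve satisfies (module docstring of `KimAtThreeD7uTamagawaDefectExponentLe`).  Here the three
theorems of part XXI are restated with `hD`, `hadm` asked for `i ≤ j + n + 1` ONLY (every other binder and the
conclusions VERBATIM; proofs = part XXI's over part XV-le).  Part XXVI constructs such families under the tower.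

* `exists_isKolyvaginSystem_map_torsionInclusion_eq_add_le` — `3^{n+1} ∣ c_ℓ` for one `ℓ ∤ 3` ⇒ every Kolyvagin
  system of `(E[3^{j+n+1}·3], 𝓕_u, D (j+n+1))` is `incl_* λ`, `λ` a Kolyvagin system of `(E[3^j·3], 𝓕_can, D j)`.
* `isKolyvaginSystem_blochKatoRelaxed_iff_exists_map_torsionInclusion_eq_add_le`,
  `natCard_kolyvaginSystems_blochKatoRelaxed_eq_add_le` — with `n + 1 = max_ℓ v₃(c_ℓ)`:
  `KS(E[3^{j+n+1}·3], 𝓕_u) = incl_* KS(E[3^j·3], 𝓕_can)` and `#` equal, every `j`.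

References: K. Büyükboduk, JNT 129 (2009) Thm. 3.1, §4.2; B. Mazur, K. Rubin, Mem. AMS 799 (2004) App. A Remark A.5;
R. Sakamoto, JTNB 36 (2024) Def. 3.5, Def. 4.1, Thm. 4.4 (1); K. Rubin, PCMI 18 (2011) Def. 1.9.6.
-/

noncomputable section

-- the cell's Theorems namespace `Summit.BirchSwinnertonDyer.BirchSwinnertonDyer.…` repeats the summit name by design (D-0017)
set_option linter.dupNamespace false

open scoped Classical NumberField ContRepresentation
open Function Field NumberField IsDedekindDomain Module
open WeierstrassCurve Literature.NumberTheory.EllipticCurves Literature.NumberTheory.GaloisRepresentations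
  Literature.NumberTheory.GaloisRepresentations.DiscreteGaloisModule Literature.NumberTheory.GaloisCohomology
open Summit.BirchSwinnertonDyer.Rank1Residual Summit.BirchSwinnertonDyer.Rank1Residual.GaloisImage
open Summit.BirchSwinnertonDyer.Rank1Residual.GaloisImage.KSDevissage
open Summit.BirchSwinnertonDyer.Rank1Residual.GaloisImage.TorsionLevel
open Summit.BirchSwinnertonDyer.BirchSwinnertonDyer.Theorems.KimAtThreeD7uTamagawaFreeProduct
open Summit.BirchSwinnertonDyer.BirchSwinnertonDyer.Theorems.KimAtThreeD7uTamagawaDefectDevissage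

namespace Summit.BirchSwinnertonDyer.BirchSwinnertonDyer.Theorems.KimAtThreeD7uTamagawaSharp

section TowerLe

variable (W : WeierstrassCurve ℚ) [W.IsElliptic]

/-- (-le CONSUMER FORM: `hD`/`hadm` for `i ≤ j + n + 1` only.) **THE WHOLE TOWER (surjectivity half): `n + 1` levels past ANY level `j`, every Kolyvagin system for
`𝓕_u` on `E[3^{j+n+1}·3]` comes from `E[3^j·3]` as soon as `3^{n+1} ∣ c_ℓ` for ONE `ℓ ∤ 3`.**  Binders: part XV's
at level `n` (Poitou–Tate family `inv`, `hEP`, `T ⊇ {3} ∪ bad`, no `Γ_ℚ`-fixed points, `τ` with (H.2)-shape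
cokernels, canonical admissible Kolyvagin data `D i` on every `E[3^i·3]` with ONE prime set `P` outside `T`,
cyclotomic transverse conditions, ONE `η`, the level-one prime choice) read at the top level `j + n + 1`
(`τ` fixes `μ_{3^{j+n+2}}`, `P ⊆ 𝒫_{3^{j+n+2}}`).  CONCLUSION: every Kolyvagin system `κ` of
`(E[3^{j+n+1}·3], 𝓕_u = blochKatoSelmerStructure 3 (tateTorsionDatum W 3 (j+n+1)) ⊤, D (j+n+1))` is `incl_* λ`
for a Kolyvagin system `λ` of `(E[3^j·3], 𝓕_can = propagatedSelmerStructure W 3 j, D j)`: `red_* κ`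
(`red = 3^{j+1} : E[3^{j+n+1}·3] → E[3^n·3]`, part XVIII §2) is a Kolyvagin system for `𝓕_u` on `E[3^n·3]`,
hence `0` (part XV), so `κ = incl_* λ` (part XX §2), and `λ` is a Kolyvagin system by n1011-p15's pull-back:
`𝓕_u ≤ 𝓕_can` is CARTESIAN along `incl` (part XX §1), transverse conditions pull back from the local shapes
at Sakamoto's primes (part XX §2's local injectivity), the canonical comparison maps reflect (n1011-p15 F-B1b).
Part XVIII §3 is the case `j = 0`. [cite: Buyukboduk2009TamagawaDefect, Thm. 3.1 and §4.2 Questions 1–2]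
[cite: MazurRubin2004, App. A Remark A.5 (p. 81)] [cite: Sakamoto2024, Def. 3.5 (p. 923) and Def. 4.1 (p. 926)] -/
theorem exists_isKolyvaginSystem_map_torsionInclusion_eq_add_le [Finite (geomTorsion W ((3 : ℕ) : ℤ))]
    [Finite (geomTorsion W (((3 : ℕ) : ℤ) ^ 0 * ((3 : ℕ) : ℤ)))]
    {inv : LocalInvariants ℚ 3}
    (hperf : inv.IsPerfect) (hsum : inv.SumLocalTermEqZero) (hcompl : inv.SelmerComplement)
    (hEP : ∀ v : HeightOneSpectrum (𝓞 ℚ), localEulerPoincareCharacteristic (v.adicCompletion ℚ))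
    (T : Finset (HeightOneSpectrum (𝓞 ℚ)))
    (h3T : ∀ v : HeightOneSpectrum (𝓞 ℚ), ((3 : ℕ) : 𝓞 ℚ) ∈ v.asIdeal → v ∈ T)
    (hbadT : ∀ v : HeightOneSpectrum (𝓞 ℚ), ¬ W.HasGoodReductionAt v → v ∈ T) (j n : ℕ)
    {ℓ : HeightOneSpectrum (𝓞 ℚ)} (h3ℓ : ((3 : ℕ) : 𝓞 ℚ) ∉ ℓ.asIdeal)
    (hn : 3 ^ (n + 1) ∣ (W.baseChange (ℓ.adicCompletion ℚ)).localTamagawaNumber (ℓ.adicCompletionIntegers ℚ))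
    (h0 : ∀ (i : ℕ) (P : geomTorsion W (((3 : ℕ) : ℤ) ^ i * ((3 : ℕ) : ℤ))),
      (∀ σ : absoluteGaloisGroup ℚ,
        W.torsionGaloisModule (((3 : ℕ) : ℤ) ^ i * ((3 : ℕ) : ℤ)) σ P = P) → P = 0)
    {Sset : Set (HeightOneSpectrum (𝓞 ℚ))} {τ : absoluteGaloisGroup ℚ}
    (hτ : ∀ i : ℕ, Nonempty (cokerSubOne (W.torsionGaloisModule (((3 : ℕ) : ℤ) ^ i * ((3 : ℕ) : ℤ))) τ ≃+
      ZMod (3 ^ (i + 1))))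
    (hτ₁ : Nonempty (cokerSubOne (W.torsionGaloisModule ((3 : ℕ) : ℤ)) τ ≃+ ZMod 3))
    (hτμ : τ ∈ rootsOfUnityFixer ℚ (3 ^ (j + n + 1 + 1)))
    (D : (i : ℕ) → KolyvaginDatum (W.torsionGaloisModule (((3 : ℕ) : ℤ) ^ i * ((3 : ℕ) : ℤ))))
    {P : Set (HeightOneSpectrum (𝓞 ℚ))} (hP : ∀ i, (D i).primes = P) (hPT : ∀ q ∈ P, q ∉ T)
    (hPc : P ⊆ frobeniusClassPrimes
      (W.torsionGaloisModule (((3 : ℕ) : ℤ) ^ (j + n + 1) * ((3 : ℕ) : ℤ))) Sset τ (3 ^ (j + n + 1 + 1)))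
    (hT : ∀ i, (D i).transverse = cyclotomicTransverse _)
    {η : (q : HeightOneSpectrum (𝓞 ℚ)) → (ZMod (Ideal.absNorm q.asIdeal))ˣ}
    (hD : ∀ i, i ≤ j + n + 1 → (D i).HasCanonicalComparison (3 ^ (i + 1)) η)
    (hadm : ∀ i, i ≤ j + n + 1 → (D i).IsAdmissible)
    (hprime : ∀ c : galoisCohomology (W.torsionGaloisModule (((3 : ℕ) : ℤ) ^ 0 * ((3 : ℕ) : ℤ))) 1, c ≠ 0 →
      ∀ c' : galoisCohomology (DiscreteGaloisModule.tateDual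
        (W.torsionGaloisModule (((3 : ℕ) : ℤ) ^ 0 * ((3 : ℕ) : ℤ))) 3) 1, c' ≠ 0 →
      {q ∈ (D 0).primes |
        galoisCohomology.localization (W.torsionGaloisModule (((3 : ℕ) : ℤ) ^ 0 * ((3 : ℕ) : ℤ)))
          (Sum.inr q) 1 c ≠ 0 ∧
        galoisCohomology.localization (DiscreteGaloisModule.tateDual
          (W.torsionGaloisModule (((3 : ℕ) : ℤ) ^ 0 * ((3 : ℕ) : ℤ))) 3) (Sum.inr q) 1 c' ≠ 0}.Infinite)
    {κ : Finset (HeightOneSpectrum (𝓞 ℚ)) →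
      galoisCohomology (W.torsionGaloisModule (((3 : ℕ) : ℤ) ^ (j + n + 1) * ((3 : ℕ) : ℤ))) 1}
    (hκ : (D (j + n + 1)).IsKolyvaginSystem
      (blochKatoSelmerStructure 3 (tateTorsionDatum W 3 (j + n + 1)) (fun _ _ => ⊤)) κ) :
    ∃ lam : Finset (HeightOneSpectrum (𝓞 ℚ)) →
        galoisCohomology (W.torsionGaloisModule (((3 : ℕ) : ℤ) ^ j * ((3 : ℕ) : ℤ))) 1,
      (D j).IsKolyvaginSystem (propagatedSelmerStructure W 3 j) lam ∧
        ∀ d, galoisCohomology.map (W.torsionInclusion (pow_mul_dvd_pow_mul_of_le 3 (le_add_add_one j n))) 1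
          (lam d) = κ d := by
  classical
  haveI : Fact (Nat.Prime 3) := ⟨Nat.prime_three⟩
  haveI : Fact (1 < 3 ^ (j + 1)) := ⟨Nat.one_lt_pow (Nat.succ_ne_zero _) (by norm_num)⟩
  haveI : NeZero (3 ^ (j + n + 1 + 1)) := ⟨pow_ne_zero _ (by norm_num)⟩
  haveI : Finite (geomTorsion W (((3 : ℕ) : ℤ) ^ (j + n + 1) * ((3 : ℕ) : ℤ))) :=
    finite_geomTorsion_pow_mul W 3 (j + n + 1)
  -- the reduction `red : E[3^{j+n+1}·3] → E[3^n·3]`, `x ↦ 3^{j+1} x`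
  obtain ⟨red, hred'⟩ := exists_torsionReduction_pow_mul W 3 n (j + n + 1)
  have hred : ∀ x : geomTorsion W (((3 : ℕ) : ℤ) ^ (j + n + 1) * ((3 : ℕ) : ℤ)),
      ((red x : geomTorsion W (((3 : ℕ) : ℤ) ^ n * ((3 : ℕ) : ℤ))) : geomPoints W) =
        (((3 : ℕ) : ℤ) ^ (j + 1)) • (x : geomPoints W) := fun x => by
    rw [hred', show j + n + 1 - n = j + 1 by omega]
  set incl := W.torsionInclusion (pow_mul_dvd_pow_mul_of_le 3 (le_add_add_one j n)) with hincl
  -- bookkeeping: primes, good reduction, sub-classes, roots of unity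
  haveI : Finite (geomTorsion W (((3 : ℕ) : ℤ) ^ j * ((3 : ℕ) : ℤ))) := finite_geomTorsion_pow_mul W 3 j
  haveI : Finite (geomTorsion W (((3 : ℕ) : ℤ) ^ n * ((3 : ℕ) : ℤ))) := finite_geomTorsion_pow_mul W 3 n
  have hP₂ : (D (j + n + 1)).primes ⊆ frobeniusClassPrimes (W.torsionGaloisModule (((3 : ℕ) : ℤ) ^ (j + n + 1) * ((3 : ℕ) : ℤ))) Sset τ (3 ^ (j + n + 1 + 1)) := by
    rw [hP (j + n + 1)]; exact hPc
  have hgood : ∀ q ∈ (D (j + n + 1)).primes, ((3 : ℕ) : 𝓞 ℚ) ∉ q.asIdeal ∧ W.HasGoodReductionAt q := by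
    intro q hq
    rw [hP (j + n + 1)] at hq
    exact ⟨fun h => hPT q hq (h3T q h), by by_contra h; exact hPT q hq (hbadT q h)⟩
  have hdvd_n : 3 ^ (n + 1) ∣ 3 ^ (j + n + 1 + 1) := pow_dvd_pow 3 (by omega)
  have hdvd_j : 3 ^ (j + 1) ∣ 3 ^ (j + n + 1 + 1) := pow_dvd_pow 3 (by omega)
  have hker_n : ∀ u : absoluteGaloisGroup ℚ, (W.torsionGaloisModule (((3 : ℕ) : ℤ) ^ (j + n + 1) * ((3 : ℕ) : ℤ))) u = 1 → (W.torsionGaloisModule (((3 : ℕ) : ℤ) ^ n * ((3 : ℕ) : ℤ))) u = 1 := fun u hu =>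
    torsionGaloisModule_eq_one_of_dvd W (pow_mul_dvd_pow_mul_of_le 3 (by omega : n ≤ j + n + 1)) u hu
  have hker_j : ∀ u : absoluteGaloisGroup ℚ, (W.torsionGaloisModule (((3 : ℕ) : ℤ) ^ (j + n + 1) * ((3 : ℕ) : ℤ))) u = 1 → (W.torsionGaloisModule (((3 : ℕ) : ℤ) ^ j * ((3 : ℕ) : ℤ))) u = 1 := fun u hu =>
    torsionGaloisModule_eq_one_of_dvd W (pow_mul_dvd_pow_mul_of_le 3 (le_add_add_one j n)) u hu
  have hPc_n : P ⊆ frobeniusClassPrimes (W.torsionGaloisModule (((3 : ℕ) : ℤ) ^ n * ((3 : ℕ) : ℤ))) Sset τ (3 ^ (n + 1)) := fun q hq =>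
    S24Deep.frobeniusClassPrimes_mono _ _ hker_n Sset τ hdvd_n (hPc hq)
  have hmono_j : ∀ q ∈ (D (j + n + 1)).primes, q ∈ frobeniusClassPrimes (W.torsionGaloisModule (((3 : ℕ) : ℤ) ^ j * ((3 : ℕ) : ℤ))) Sset τ (3 ^ (j + 1)) :=
    fun q hq => S24Deep.frobeniusClassPrimes_mono _ _ hker_j Sset τ hdvd_j (hP₂ hq)
  have hτμ_n : τ ∈ rootsOfUnityFixer ℚ (3 ^ (n + 1)) := rootsOfUnityFixer_le_of_dvd ℚ hdvd_n hτμ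
  have hτμ_j : τ ∈ rootsOfUnityFixer ℚ (3 ^ (j + 1)) := rootsOfUnityFixer_le_of_dvd ℚ hdvd_j hτμ
  have hMtop0 : ∀ m : geomTorsion W (((3 : ℕ) : ℤ) ^ (j + n + 1) * ((3 : ℕ) : ℤ)), 3 ^ (j + n + 1 + 1) • m = 0 :=
    pow_succ_nsmul_geomTorsion_eq_zero W 3 (j + n + 1)
  have hMj0 : ∀ m : geomTorsion W (((3 : ℕ) : ℤ) ^ j * ((3 : ℕ) : ℤ)), 3 ^ (j + 1) • m = 0 :=
    pow_succ_nsmul_geomTorsion_eq_zero W 3 j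
  have hprimeN : ∀ q : HeightOneSpectrum (𝓞 ℚ), Fact (Ideal.absNorm q.asIdeal).Prime :=
    fun q => ⟨FSComp.prime_absNorm_rat q⟩
  have hne : ∀ q : HeightOneSpectrum (𝓞 ℚ),
      NeZero ((Ideal.absNorm q.asIdeal : ℕ) : q.adicCompletion ℚ) := fun q => by
    haveI : CharZero (q.adicCompletion ℚ) :=
      charZero_of_injective_algebraMap (algebraMap ℚ (q.adicCompletion ℚ)).injective
    exact ⟨Nat.cast_ne_zero.2 (FSComp.prime_absNorm_rat q).ne_zero⟩
  -- local shapes at the Kolyvagin primes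
  have hsup_j : ∀ q ∈ (D (j + n + 1)).primes,
      unramifiedSubgroup (GaloisRep.toLocal q (W.torsionGaloisModule (((3 : ℕ) : ℤ) ^ j * ((3 : ℕ) : ℤ)))) 1 ⊔ cyclotomicTransverse (W.torsionGaloisModule (((3 : ℕ) : ℤ) ^ j * ((3 : ℕ) : ℤ))) (Sum.inr q) = ⊤ := fun q hq => by
    haveI := hprimeN q; haveI := hne q
    exact unramifiedSubgroup_sup_cyclotomicTransverse_eq_top_of_mem_frobeniusClassPrimes (W.torsionGaloisModule (((3 : ℕ) : ℤ) ^ j * ((3 : ℕ) : ℤ))) (hmono_j q hq)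
      (absNorm_sub_one_smul_eq_zero_of_mem_frobeniusClassPrimes (W.torsionGaloisModule (((3 : ℕ) : ℤ) ^ j * ((3 : ℕ) : ℤ))) (hmono_j q hq) hτμ_j hMj0)
      (modPCyclotomicCharacter_surjOn_absInertia_rat_holds q)
  have hMtop' : ∀ q ∈ (D (j + n + 1)).primes, ∀ m : geomTorsion W (((3 : ℕ) : ℤ) ^ (j + n + 1) * ((3 : ℕ) : ℤ)),
      (Ideal.absNorm q.asIdeal - 1) • m = 0 := fun q hq =>
    absNorm_sub_one_smul_eq_zero_of_mem_frobeniusClassPrimes (W.torsionGaloisModule (((3 : ℕ) : ℤ) ^ (j + n + 1) * ((3 : ℕ) : ℤ))) (hP₂ hq) hτμ hMtop0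
  have hU : ∀ q ∈ (D (j + n + 1)).primes,
      Nat.card (unramifiedSubgroup (GaloisRep.toLocal q (W.torsionGaloisModule (((3 : ℕ) : ℤ) ^ (j + n + 1) * ((3 : ℕ) : ℤ)))) 1) = 3 ^ (j + n + 1 + 1) := fun q hq =>
    natCard_unramifiedSubgroup_toLocal_of_mem_frobeniusClassPrimes (W.torsionGaloisModule (((3 : ℕ) : ℤ) ^ (j + n + 1) * ((3 : ℕ) : ℤ))) (hP₂ hq) (hτ (j + n + 1))
  have hTc : ∀ q ∈ (D (j + n + 1)).primes,
      Nat.card ((D (j + n + 1)).transverse (Sum.inr q)) = 3 ^ (j + n + 1 + 1) := fun q hq => by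
    haveI := hprimeN q; haveI := hne q
    rw [hT (j + n + 1)]
    exact natCard_cyclotomicTransverse_rat_of_mem_frobeniusClassPrimes' (W.torsionGaloisModule (((3 : ℕ) : ℤ) ^ (j + n + 1) * ((3 : ℕ) : ℤ))) (hP₂ hq) (hτ (j + n + 1))
      (hMtop' q hq)
  have hUT : ∀ q ∈ (D (j + n + 1)).primes,
      unramifiedSubgroup (GaloisRep.toLocal q (W.torsionGaloisModule (((3 : ℕ) : ℤ) ^ (j + n + 1) * ((3 : ℕ) : ℤ)))) 1 ⊔ (D (j + n + 1)).transverse (Sum.inr q) = ⊤ :=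
    fun q hq => by
      haveI := hprimeN q; haveI := hne q
      rw [hT (j + n + 1)]
      exact unramifiedSubgroup_sup_cyclotomicTransverse_eq_top_of_mem_frobeniusClassPrimes (W.torsionGaloisModule (((3 : ℕ) : ℤ) ^ (j + n + 1) * ((3 : ℕ) : ℤ))) (hP₂ hq)
        (hMtop' q hq) (modPCyclotomicCharacter_surjOn_absInertia_rat_holds q)
  have hinf : ∀ q ∈ (D (j + n + 1)).primes,
      unramifiedSubgroup (GaloisRep.toLocal q (W.torsionGaloisModule (((3 : ℕ) : ℤ) ^ (j + n + 1) * ((3 : ℕ) : ℤ)))) 1 ⊓ cyclotomicTransverse (W.torsionGaloisModule (((3 : ℕ) : ℤ) ^ (j + n + 1) * ((3 : ℕ) : ℤ))) (Sum.inr q) = ⊥ :=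
    fun q hq => by
      rw [← hT (j + n + 1)]
      exact CoreRankOne.unramified_inf_transverse_eq_bot (hadm (j + n + 1) le_rfl) hU hTc hUT hq
  have hinjloc : ∀ q ∈ (D (j + n + 1)).primes, Function.Injective (localMap incl (Sum.inr q)) := fun q hq =>
    localMap_torsionInclusion_injective_add W 3 j n red hred q
      (natCard_invariants_toLocal_of_mem_frobeniusClassPrimes (W.torsionGaloisModule (((3 : ℕ) : ℤ) ^ (j + n + 1) * ((3 : ℕ) : ℤ))) (hP₂ hq) (hτ (j + n + 1)))
      (natCard_invariants_toLocal_of_mem_frobeniusClassPrimes (W.torsionGaloisModule (((3 : ℕ) : ℤ) ^ n * ((3 : ℕ) : ℤ))) (hPc_n ((hP (j + n + 1)) ▸ hq)) (hτ n))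
      (natCard_invariants_toLocal_of_mem_frobeniusClassPrimes (W.torsionGaloisModule (((3 : ℕ) : ℤ) ^ j * ((3 : ℕ) : ℤ))) (hmono_j q hq) (hτ j))
  -- Step 1–2: `red_* κ` is a Kolyvagin system for `𝓕_u` on `E[3^n·3]`, hence vanishes (part XV at level `n`)
  have hredκ : (D n).IsKolyvaginSystem (blochKatoSelmerStructure 3 (tateTorsionDatum W 3 n) (fun _ _ => ⊤))
      (fun d => galoisCohomology.map red 1 (κ d)) :=
    isKolyvaginSystem_map_red_blochKatoRelaxed W 3 (by omega : n ≤ j + n + 1) red hred' T h3T hbadT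
      ((hP n).trans (hP (j + n + 1)).symm) (fun q hq => hPT q ((hP (j + n + 1)) ▸ hq)) (hT (j + n + 1)) (hT n)
      (hD (j + n + 1) le_rfl) (hD n (by omega)) hκ
  have hzero : ∀ d, galoisCohomology.map red 1 (κ d) = 0 := fun d =>
    isKolyvaginSystem_blochKatoRelaxed_apply_eq_zero_of_pow_succ_dvd_le W hperf hsum hcompl hEP T h3T hbadT h3ℓ
      n hn h0 hτ hτ₁ hτμ_n D hP hPT hPc_n hT (fun i hi => hD i (by omega)) (fun i hi => hadm i (by omega)) hprime
      hredκ d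
  -- Step 3: lift along `incl`
  obtain ⟨lam, hlam, hlam0⟩ := exists_lift_of_forall_mem_range incl
    (map_torsionInclusion_injective_of_le W 3 (le_add_add_one j n) (h0 (j + n + 1)))
    (fun d => exists_map_torsionInclusion_eq_of_map_red_eq_zero_add W 3 j n red hred (κ d) (hzero d))
  -- Step 4: the lift is a Kolyvagin system for `𝓕_can` on `E[3^j·3]`
  obtain ⟨red', m, b, b', hb⟩ := exists_bases_red_top_to_sub W 3 j n
  refine ⟨lam, isKolyvaginSystem_lift incl ((hP j).trans (hP (j + n + 1)).symm) ?_ ?_ ?_ ?_ hκ hlam hlam0, hlam⟩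
  · -- `𝓕_can` on `E[3^j·3]` is unramified at the (good) primes
    intro q hq
    exact (propagatedSelmerStructure_inr_eq_unramifiedSubgroup W 3 j (hgood q hq).1 (hgood q hq).2).le
  · -- `𝓕_u ≤ 𝓕_can`, and `𝓕_can` is cartesian along `incl` (part XX §1)
    intro v x hx
    exact mem_propagatedSelmerStructure_of_localMap_torsionInclusion_mem W 3 (le_add_add_one j n) v x
      (blochKatoSelmerStructure_relaxed_le_propagatedSelmerStructure W 3 (j + n + 1) (by norm_num) v hx)
  · -- transverse pull-back from the local shapes
    intro q hq x hx
    rw [hT (j + n + 1)] at hx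
    rw [hT j]
    exact mem_cyclotomicTransverse_of_localMap_mem incl q (hsup_j q hq) (hinf q hq) (hinjloc q hq) hx
  · -- reflection of the canonical comparison maps along `incl` (n1011-p15 F-B1b)
    intro q hq y hy w hw
    exact singularMap_eq_fs_of_localMap_of_hasCanonicalComparison hdvd_j red' b b' hb incl
      (isSES_torsionInclusion_red_add W 3 j n red hred).injective (hD (j + n + 1) le_rfl) (hD j (by omega)) hq
      (by rw [hP j, ← hP (j + n + 1)]; exact hq) (hP₂ hq).2.2.1 (hmono_j q hq).2.2.1 hy w hw


/-! ### §2 The IDENTIFICATION and the cardinality at every level past the threshold -/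

/-- **`KS(E[3^{j+n+1}·3], 𝓕_u, D (j+n+1)) = incl_* KS(E[3^j·3], 𝓕_can, D j)` whenever `n + 1 = max_ℓ v₃(c_ℓ)`**
(both inclusions, every `j`): under the binders of `exists_isKolyvaginSystem_map_torsionInclusion_eq_add_le`
(`3^{n+1} ∣ c_ℓ` for ONE `ℓ ∤ 3`) and the maximality `3^{v₃(c_w)} ∣ 3^{n+1}` at EVERY finite `w ∤ 3`, a family
`κ` is a Kolyvagin system of `(E[3^{j+n+1}·3], 𝓕_u, D (j+n+1))` IFF it is `incl_* λ` for a Kolyvagin system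
`λ` of `(E[3^j·3], 𝓕_can, D j)` — (⇒) §1, (⇐) part XVII §5.  In words: at EVERY level past the threshold
`max = max_ℓ v₃(c_ℓ)` the module of `𝓕_u`-Kolyvagin systems on `E[3^m]` IS the image of `KS(E[3^{m-max}], 𝓕_can)`
under `incl_*` (the finite-level form of `KS(T₃E, 𝓕_u) = 3^{max}·KS(T₃E, 𝓕_can)`); parts XVIII/XIX are the case
`m = max + 1`. [cite: Buyukboduk2009TamagawaDefect, Thm. 3.1 and §4.2 Questions 1–2]
[cite: MazurRubin2004, App. A Remark A.5 (p. 81)] [cite: Sakamoto2024, Thm. 4.4 (1) (p. 926)] -/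
theorem isKolyvaginSystem_blochKatoRelaxed_iff_exists_map_torsionInclusion_eq_add_le
    [Finite (geomTorsion W ((3 : ℕ) : ℤ))] [Finite (geomTorsion W (((3 : ℕ) : ℤ) ^ 0 * ((3 : ℕ) : ℤ)))]
    {inv : LocalInvariants ℚ 3}
    (hperf : inv.IsPerfect) (hsum : inv.SumLocalTermEqZero) (hcompl : inv.SelmerComplement)
    (hEP : ∀ v : HeightOneSpectrum (𝓞 ℚ), localEulerPoincareCharacteristic (v.adicCompletion ℚ))
    (T : Finset (HeightOneSpectrum (𝓞 ℚ)))
    (h3T : ∀ v : HeightOneSpectrum (𝓞 ℚ), ((3 : ℕ) : 𝓞 ℚ) ∈ v.asIdeal → v ∈ T)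
    (hbadT : ∀ v : HeightOneSpectrum (𝓞 ℚ), ¬ W.HasGoodReductionAt v → v ∈ T) (j n : ℕ)
    {ℓ : HeightOneSpectrum (𝓞 ℚ)} (h3ℓ : ((3 : ℕ) : 𝓞 ℚ) ∉ ℓ.asIdeal)
    (hn : 3 ^ (n + 1) ∣ (W.baseChange (ℓ.adicCompletion ℚ)).localTamagawaNumber (ℓ.adicCompletionIntegers ℚ))
    (htam : ∀ w : HeightOneSpectrum (𝓞 ℚ), ((3 : ℕ) : 𝓞 ℚ) ∉ w.asIdeal →
      3 ^ padicValNat 3 ((W.baseChange (w.adicCompletion ℚ)).localTamagawaNumber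
        (w.adicCompletionIntegers ℚ)) ∣ 3 ^ (n + 1))
    (h0 : ∀ (i : ℕ) (P : geomTorsion W (((3 : ℕ) : ℤ) ^ i * ((3 : ℕ) : ℤ))),
      (∀ σ : absoluteGaloisGroup ℚ,
        W.torsionGaloisModule (((3 : ℕ) : ℤ) ^ i * ((3 : ℕ) : ℤ)) σ P = P) → P = 0)
    {Sset : Set (HeightOneSpectrum (𝓞 ℚ))} {τ : absoluteGaloisGroup ℚ}
    (hτ : ∀ i : ℕ, Nonempty (cokerSubOne (W.torsionGaloisModule (((3 : ℕ) : ℤ) ^ i * ((3 : ℕ) : ℤ))) τ ≃+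
      ZMod (3 ^ (i + 1))))
    (hτ₁ : Nonempty (cokerSubOne (W.torsionGaloisModule ((3 : ℕ) : ℤ)) τ ≃+ ZMod 3))
    (hτμ : τ ∈ rootsOfUnityFixer ℚ (3 ^ (j + n + 1 + 1)))
    (D : (i : ℕ) → KolyvaginDatum (W.torsionGaloisModule (((3 : ℕ) : ℤ) ^ i * ((3 : ℕ) : ℤ))))
    {P : Set (HeightOneSpectrum (𝓞 ℚ))} (hP : ∀ i, (D i).primes = P) (hPT : ∀ q ∈ P, q ∉ T)
    (hPc : P ⊆ frobeniusClassPrimes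
      (W.torsionGaloisModule (((3 : ℕ) : ℤ) ^ (j + n + 1) * ((3 : ℕ) : ℤ))) Sset τ (3 ^ (j + n + 1 + 1)))
    (hT : ∀ i, (D i).transverse = cyclotomicTransverse _)
    {η : (q : HeightOneSpectrum (𝓞 ℚ)) → (ZMod (Ideal.absNorm q.asIdeal))ˣ}
    (hD : ∀ i, i ≤ j + n + 1 → (D i).HasCanonicalComparison (3 ^ (i + 1)) η)
    (hadm : ∀ i, i ≤ j + n + 1 → (D i).IsAdmissible)
    (hprime : ∀ c : galoisCohomology (W.torsionGaloisModule (((3 : ℕ) : ℤ) ^ 0 * ((3 : ℕ) : ℤ))) 1, c ≠ 0 →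
      ∀ c' : galoisCohomology (DiscreteGaloisModule.tateDual
        (W.torsionGaloisModule (((3 : ℕ) : ℤ) ^ 0 * ((3 : ℕ) : ℤ))) 3) 1, c' ≠ 0 →
      {q ∈ (D 0).primes |
        galoisCohomology.localization (W.torsionGaloisModule (((3 : ℕ) : ℤ) ^ 0 * ((3 : ℕ) : ℤ)))
          (Sum.inr q) 1 c ≠ 0 ∧
        galoisCohomology.localization (DiscreteGaloisModule.tateDual
          (W.torsionGaloisModule (((3 : ℕ) : ℤ) ^ 0 * ((3 : ℕ) : ℤ))) 3) (Sum.inr q) 1 c' ≠ 0}.Infinite)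
    (κ : Finset (HeightOneSpectrum (𝓞 ℚ)) →
      galoisCohomology (W.torsionGaloisModule (((3 : ℕ) : ℤ) ^ (j + n + 1) * ((3 : ℕ) : ℤ))) 1) :
    (D (j + n + 1)).IsKolyvaginSystem
        (blochKatoSelmerStructure 3 (tateTorsionDatum W 3 (j + n + 1)) (fun _ _ => ⊤)) κ ↔
      ∃ lam : Finset (HeightOneSpectrum (𝓞 ℚ)) →
          galoisCohomology (W.torsionGaloisModule (((3 : ℕ) : ℤ) ^ j * ((3 : ℕ) : ℤ))) 1,
        (D j).IsKolyvaginSystem (propagatedSelmerStructure W 3 j) lam ∧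
          ∀ d, galoisCohomology.map (W.torsionInclusion (pow_mul_dvd_pow_mul_of_le 3 (le_add_add_one j n))) 1
            (lam d) = κ d := by
  haveI : Fact (Nat.Prime 3) := ⟨Nat.prime_three⟩
  refine ⟨fun hκ => exists_isKolyvaginSystem_map_torsionInclusion_eq_add_le W hperf hsum hcompl hEP T h3T hbadT j n h3ℓ hn h0 hτ hτ₁ hτμ D hP hPT hPc hT hD hadm hprime hκ, ?_⟩
  rintro ⟨lam, hlam, hEq⟩
  rw [show κ = (fun d => galoisCohomology.map
      (W.torsionInclusion (pow_mul_dvd_pow_mul_of_le 3 (le_add_add_one j n))) 1 (lam d)) from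
    funext fun d => (hEq d).symm]
  exact isKolyvaginSystem_map_torsionInclusion_blochKatoRelaxed W 3 (le_add_add_one j n)
    (fun w hw => by rw [show j + n + 1 - j = n + 1 by omega]; exact htam w hw) T h3T hbadT
    ((hP (j + n + 1)).trans (hP j).symm) (fun q hq => hPT q ((hP j) ▸ hq)) (hT j) (hT (j + n + 1))
    (hD j (by omega)) (hD (j + n + 1) le_rfl) hlam

/-- **`#KS(E[3^{j+n+1}·3], 𝓕_u, D (j+n+1)) = #KS(E[3^j·3], 𝓕_can, D j)` whenever `n + 1 = max_ℓ v₃(c_ℓ)`**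
(`= 3^{j+1}` under [S24] Thm. 4.4 (1)): `λ ↦ incl_* λ` is a bijection between the two groups of Kolyvagin
systems (injective: no `Γ_ℚ`-fixed points, part XVII §6; surjective: §1) — at every level past the threshold
the `𝓕_u`-module is a copy of the `𝓕_can`-module `max` levels lower, while at and below the threshold it is
`0` (part XV). [cite: Buyukboduk2009TamagawaDefect, Thm. 3.1 and §4.2 Questions 1–2]
[cite: Sakamoto2024, Thm. 4.4 (1) (p. 926)] -/
theorem natCard_kolyvaginSystems_blochKatoRelaxed_eq_add_le
    [Finite (geomTorsion W ((3 : ℕ) : ℤ))] [Finite (geomTorsion W (((3 : ℕ) : ℤ) ^ 0 * ((3 : ℕ) : ℤ)))]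
    {inv : LocalInvariants ℚ 3}
    (hperf : inv.IsPerfect) (hsum : inv.SumLocalTermEqZero) (hcompl : inv.SelmerComplement)
    (hEP : ∀ v : HeightOneSpectrum (𝓞 ℚ), localEulerPoincareCharacteristic (v.adicCompletion ℚ))
    (T : Finset (HeightOneSpectrum (𝓞 ℚ)))
    (h3T : ∀ v : HeightOneSpectrum (𝓞 ℚ), ((3 : ℕ) : 𝓞 ℚ) ∈ v.asIdeal → v ∈ T)
    (hbadT : ∀ v : HeightOneSpectrum (𝓞 ℚ), ¬ W.HasGoodReductionAt v → v ∈ T) (j n : ℕ)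
    {ℓ : HeightOneSpectrum (𝓞 ℚ)} (h3ℓ : ((3 : ℕ) : 𝓞 ℚ) ∉ ℓ.asIdeal)
    (hn : 3 ^ (n + 1) ∣ (W.baseChange (ℓ.adicCompletion ℚ)).localTamagawaNumber (ℓ.adicCompletionIntegers ℚ))
    (htam : ∀ w : HeightOneSpectrum (𝓞 ℚ), ((3 : ℕ) : 𝓞 ℚ) ∉ w.asIdeal →
      3 ^ padicValNat 3 ((W.baseChange (w.adicCompletion ℚ)).localTamagawaNumber
        (w.adicCompletionIntegers ℚ)) ∣ 3 ^ (n + 1))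
    (h0 : ∀ (i : ℕ) (P : geomTorsion W (((3 : ℕ) : ℤ) ^ i * ((3 : ℕ) : ℤ))),
      (∀ σ : absoluteGaloisGroup ℚ,
        W.torsionGaloisModule (((3 : ℕ) : ℤ) ^ i * ((3 : ℕ) : ℤ)) σ P = P) → P = 0)
    {Sset : Set (HeightOneSpectrum (𝓞 ℚ))} {τ : absoluteGaloisGroup ℚ}
    (hτ : ∀ i : ℕ, Nonempty (cokerSubOne (W.torsionGaloisModule (((3 : ℕ) : ℤ) ^ i * ((3 : ℕ) : ℤ))) τ ≃+
      ZMod (3 ^ (i + 1))))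
    (hτ₁ : Nonempty (cokerSubOne (W.torsionGaloisModule ((3 : ℕ) : ℤ)) τ ≃+ ZMod 3))
    (hτμ : τ ∈ rootsOfUnityFixer ℚ (3 ^ (j + n + 1 + 1)))
    (D : (i : ℕ) → KolyvaginDatum (W.torsionGaloisModule (((3 : ℕ) : ℤ) ^ i * ((3 : ℕ) : ℤ))))
    {P : Set (HeightOneSpectrum (𝓞 ℚ))} (hP : ∀ i, (D i).primes = P) (hPT : ∀ q ∈ P, q ∉ T)
    (hPc : P ⊆ frobeniusClassPrimes
      (W.torsionGaloisModule (((3 : ℕ) : ℤ) ^ (j + n + 1) * ((3 : ℕ) : ℤ))) Sset τ (3 ^ (j + n + 1 + 1)))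
    (hT : ∀ i, (D i).transverse = cyclotomicTransverse _)
    {η : (q : HeightOneSpectrum (𝓞 ℚ)) → (ZMod (Ideal.absNorm q.asIdeal))ˣ}
    (hD : ∀ i, i ≤ j + n + 1 → (D i).HasCanonicalComparison (3 ^ (i + 1)) η)
    (hadm : ∀ i, i ≤ j + n + 1 → (D i).IsAdmissible)
    (hprime : ∀ c : galoisCohomology (W.torsionGaloisModule (((3 : ℕ) : ℤ) ^ 0 * ((3 : ℕ) : ℤ))) 1, c ≠ 0 →
      ∀ c' : galoisCohomology (DiscreteGaloisModule.tateDual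
        (W.torsionGaloisModule (((3 : ℕ) : ℤ) ^ 0 * ((3 : ℕ) : ℤ))) 3) 1, c' ≠ 0 →
      {q ∈ (D 0).primes |
        galoisCohomology.localization (W.torsionGaloisModule (((3 : ℕ) : ℤ) ^ 0 * ((3 : ℕ) : ℤ)))
          (Sum.inr q) 1 c ≠ 0 ∧
        galoisCohomology.localization (DiscreteGaloisModule.tateDual
          (W.torsionGaloisModule (((3 : ℕ) : ℤ) ^ 0 * ((3 : ℕ) : ℤ))) 3) (Sum.inr q) 1 c' ≠ 0}.Infinite) :
    Nat.card ((D (j + n + 1)).kolyvaginSystems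
        (blochKatoSelmerStructure 3 (tateTorsionDatum W 3 (j + n + 1)) (fun _ _ => ⊤))) =
      Nat.card ((D j).kolyvaginSystems (propagatedSelmerStructure W 3 j)) := by
  haveI : Fact (Nat.Prime 3) := ⟨Nat.prime_three⟩
  have hiff := isKolyvaginSystem_blochKatoRelaxed_iff_exists_map_torsionInclusion_eq_add_le W hperf hsum hcompl hEP T h3T hbadT j n h3ℓ hn htam h0 hτ hτ₁ hτμ D hP hPT hPc hT hD hadm hprime
  symm
  refine Nat.card_congr (Equiv.ofBijective
    (fun lam => ⟨fun d => galoisCohomology.map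
        (W.torsionInclusion (pow_mul_dvd_pow_mul_of_le 3 (le_add_add_one j n))) 1 (lam.1 d),
      (KolyvaginDatum.mem_kolyvaginSystems_iff _ _ _).mpr ((hiff _).mpr
        ⟨lam.1, (KolyvaginDatum.mem_kolyvaginSystems_iff _ _ _).mp lam.2, fun _ => rfl⟩)⟩) ⟨?_, ?_⟩)
  · -- injective: no `Γ_ℚ`-fixed point on `E[3^{j+n+1}·3]` (part XVII §6)
    intro a b hab
    apply Subtype.ext
    have h := congrArg Subtype.val hab
    have hsub : (fun d => galoisCohomology.map
        (W.torsionInclusion (pow_mul_dvd_pow_mul_of_le 3 (le_add_add_one j n))) 1 ((a.1 - b.1) d)) = 0 := by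
      funext d
      change galoisCohomology.map _ 1 (a.1 d - b.1 d) = 0
      rw [map_sub, sub_eq_zero]
      exact congrFun h d
    exact sub_eq_zero.mp (eq_zero_of_map_torsionInclusion_eq_zero W 3 (le_add_add_one j n)
      (h0 (j + n + 1)) hsub)
  · -- surjective: §1
    rintro ⟨κ, hκ⟩
    obtain ⟨lam, hlam, hEq⟩ := (hiff κ).mp ((KolyvaginDatum.mem_kolyvaginSystems_iff _ _ _).mp hκ)
    exact ⟨⟨lam, (KolyvaginDatum.mem_kolyvaginSystems_iff _ _ _).mpr hlam⟩, Subtype.ext (funext hEq)⟩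

end TowerLe

end Summit.BirchSwinnertonDyer.BirchSwinnertonDyer.Theorems.KimAtThreeD7uTamagawaSharp

end
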